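import Summits.HodgeConjecture.HodgeConjecture.Theorems.BlochSeedDiscThreeLiftEngine
import Summits.HodgeConjecture.HodgeConjecture.Theorems.WeilTypeLadderSixfoldSlices
import HarnessLib

/-!
# Crux `BlochSeedDiscThree` (`HasHyperbolicBlochSeed 4 3`) — helper 2/2: DOOR L (the liftable door) and THE SCHOEN DICHOTOMY

§0 BEARS ON H2 — via the `d = 3` slice of Door A: `HasLocallyAlgebraicWeilAnchor 4 3`
(`Literature/AlgebraicGeometry/HodgeTheory/WeilClassesLocalAnchor.lean:155`) feeding the tree's
`WeilTypeLadder.weilSixfolds_slice_of_reach_of_localAnchor_four` (all `ℚ(√-3)`-Weil sixfolds), one arrow ABOVE the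
seed crux `BlochSeedDiscThree := HasHyperbolicBlochSeed 4 3` of hsemireg's route «EightfoldBlochSeeds»
(`hasLocallyAlgebraicWeilAnchor_of_blochSpread_of_hyperbolicBlochSeed`). Companions: `BlochSeedDiscThreeSchoenRigidity.lean`
(plan g5: TYPES (R) = `SchoenRigidity`, (Rʰ) = `SchoenRigidityHyp`, proves «(R) ⟹ no Schoen cycle is a Bloch seed»)
and `BlochSeedDiscThreeLiftEngine.lean` (helper 1/2: the ENGINE `spread_of_etaleLocalFlatLift_of_fulton` and its
bookkeeping). THIS file proves the CONVERSE SIDE («Bloch asymmetry», memo ROUND-3-RIGIDITY §3 E-b / referee ask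
R3-1): if (R) FAILS on a hyperbolically polarised frame, then the liftable Schoen cycle ALREADY delivers Door A's local
input — no semiregularity, no D4 datum, no lci question.

## What is here

* §G DOOR L (PROVED modulo ONE refereed named fact already in H2's trust base,
  `fulton1998_flatFamily_cycleClass_specialises` — Fulton 1998 Prop. 10.1 (a), Cor. 10.1, Lemma 19.1.1, Cor. 19.2 (b)):
  - `weilAnchorLocalClause_of_liftsAlongWeilFamilies` — DOOR L: an integral closed `Z ⊂ P` of codimension exactly `n`
    carrying `q·hⁿ + w` on its class line and lifting along every `√-d`-Weil family gives `WeilAnchorLocalClause n d P h w`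
    (the clause family is a Weil family: Hartshorne-projectivity from the quasi-projective total space,
    `Theorems.exists_isClosedImmersion_of_isSmoothProjectiveFamily`; Bloch's class hypothesis along it is WITNESSED by
    the global class `B = q·Hⁿ + W`, `classStaysHodge_of_globalClass`; the degenerate case `B|_{X₀} = 0` is rigidity;
    the ENGINE of 1/2 spreads `B`).
  - `weilRigidObstructed_or_localClause` — BLOCH ASYMMETRY, pointwise: for every such `(P, h, w; Z)`, EITHER `Z` is
    rigid-obstructed along some `√-d`-Weil family through `P` (the (R)-shape), OR `(P, h, w)` satisfies Door A's local
    clause. There is no third case and no class-level law can decide between the two (both are consistent with Hodge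
    theory on the versal family: the class stays Hodge everywhere).
* §H THE SCHOEN DICHOTOMY (PROVED modulo the same Fulton fact): `SchoenRigidityHyp` = (R) with the three anchor
  antecedents `IsRationalClass a`, `a ≠ 0`, `IsHyperbolicWeilType B₁ ψ₀ 4 h_K` added (exactly the anchor binders of
  `HasLocallyAlgebraicWeilAnchor 4 3`; MET ×3 for Schoen's `B₁`, CENSUS-R2: `h_K = E_B`, `disc W_K = 3⁴ ≡ (−1)⁴`);
  `hasLocallyAlgebraicWeilAnchor_of_liftable_schoenCycle`, `hasLocallyAlgebraicWeilAnchor_of_not_schoenRigidityHyp`,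
  `schoen_dichotomy : SchoenRigidityHyp ∨ HasLocallyAlgebraicWeilAnchor 4 3`;
  `weilSixfolds_three_of_not_schoenRigidityHyp`: ¬(Rʰ) ∧ Deligne's reach (`weilFamilyReach_hyperbolic`) ⟹ the Weil
  classes of EVERY `ℚ(√-3)`-Weil abelian sixfold are algebraic (tree Door A[3]). So the bankable barrier of round 3 has
  a kernel-checked COMPLEMENT: its failure is not a loss but Door A's missing input.

HONEST LABEL. (R) itself is NOT proved here (gap (R¹) of memo §3 stands: `U = T₁₀`). Nothing in §G–§H uses
`CM48Datum`'s content, `IsNormBuilt`, or `CMTypeIsPhi5`: the dichotomy is a property of the SHAPE of (R) (family-existence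
form with Bloch's class hypothesis inside), which is why it is cheap and why it is robust. Trust base of §G–§H:
`fulton1998_flatFamily_cycleClass_specialises` (named, refereed) + kernel; of the last arrow additionally
`weilFamilyReach_hyperbolic` (Deligne 1982 / van Geemen 1994, named, refereed). Farm check of record (memo form, frame
inlined): rc 0, 0 sorries, 0 warnings; axioms of `schoen_dichotomy` and `weilSixfolds_three_of_not_schoenRigidityHyp`
= [propext, Classical.choice, Quot.sound].

Provenance: cell `hodge-schoen` round 3 «(R) RIGIDITY» (director-hodge 2026-08-25T19:27:28Z); memos of record
`run/shared/lean/pub/hodge-schoen/memos/ROUND-3-RIGIDITY.md` (85fcfe7848962e66), `ROUND-3-Rigidity.lean` (b3cbc3497475185a, plan g5),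
`ROUND-3-RigidityDichotomy.lean` (fd65c70677d60b95, plan g6), `ROUND-3-ADDENDUM-g6.md`; referee audit REFEREE-REPORT.md §J (r1–r5 PASS),
§K/§L; landing set `memos/landing-R3/LANDING.md` (split of the former single file T2, sha16 30161868c9faaedf, plan g8).
Supports item `stmt-HodgeConjecture-18882` (`EightfoldBlochSeeds.BlochSeedDiscThree := HasHyperbolicBlochSeed 4 3`).

References: [Bloch1972Semiregularity] Thm. (7.4), Remark (7.5); [BuchweitzFlenner2003] Thm. 5.1, §5;
[Fulton1998] §10.1 Prop. 10.1 (a), Cor. 10.1, §19.1 Lemma 19.1.1, §19.2 Cor. 19.2 (b); [Schoen1988HodgeWeil] Thm 2.0,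
§3, Thm 3.3; [Deligne1982HodgeCycles] proof of Thm. 4.8; [vanGeemen1994HodgeAV] 5.2–5.4, 6.12;
[Markman2025SecantWeil] §1.5 (the local clause as the output shape of a semiregularity theorem).
-/

noncomputable section
set_option linter.dupNamespace false
open CategoryTheory CategoryTheory.Limits AlgebraicGeometry MonoidalCategory Polynomial
open Literature.AlgebraicGeometry Literature.AlgebraicGeometry.Motives
open Literature.AlgebraicGeometry.Deformation
open Literature.AlgebraicGeometry.HodgeTheory
open Literature.AlgebraicTopology.SingularHomology
open Summit.HodgeConjecture.HodgeConjecture.Theorems (exists_isOpen_forall_map_fiberι_eq_zero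
  exists_isClosedImmersion_of_isSmoothProjectiveFamily)
open Summit.HodgeConjecture.HodgeConjecture.WeilTypeLadder (weilSixfolds_slice_of_reach_of_localAnchor_four)

namespace Summit.HodgeConjecture.HodgeConjecture.Theorems.BlochSeedDiscThree

/-! ### Door L: liftability along all Weil families gives the anchor's local clause -/

/-- **DOOR L (the liftable door): a liftable carrier of `q·hⁿ + w` gives Door A's LOCAL CLAUSE.** Let `Z ⊂ P` be an
INTEGRAL closed subscheme of codimension exactly `n` of the abelian `2n`-fold `P`, whose class line carries
`q·hⁿ + w` (`classesSupportedOn`), and suppose `Z` lifts étale-locally along every `√-d`-Weil family through `P` along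
which its class stays Hodge (`LiftsAlongWeilFamilies (2n) n d P Z κ` = `¬ WeilRigidObstructed`). Then
`WeilAnchorLocalClause n d P h w`. Proof: a clause family `f : 𝒳 ⟶ S` (smooth projective abelian `2n`-folds with an
endomorphism of square `-d`, quasi-projective total space and base, smooth irreducible base) IS a Weil-type family
(Hartshorne projectivity: `Theorems.exists_isClosedImmersion_of_isSmoothProjectiveFamily`); the global class
`B = q·Hⁿ + W` is fibrewise `(n,n)` and restricts on `X₀ ≅ P` to `q·hⁿ + w`, supported on `Z` (transport of supports
along the chart `e'`, `complexBetti.restrictCompl_map_eq_zero`); if `B|_{X₀} = 0`, rigidity of the flat section ends the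
proof (`0` is algebraic); else `B` WITNESSES Bloch's class hypothesis (`classStaysHodge_of_globalClass`), the hypothesis
`hL` lifts `Z`, and the ENGINE spreads `B`. [cite: Bloch1972Semiregularity, Thm. (7.4), Remark (7.5)]
[cite: BuchweitzFlenner2003, Thm. 5.1] [cite: Markman2025SecantWeil, §1.5] -/
theorem weilAnchorLocalClause_of_liftsAlongWeilFamilies (hF : fulton1998_flatFamily_cycleClass_specialises)
    {n d : ℕ} {P : AbelianVariety ℂ} {h : complexBetti P.X 2} {w : complexBetti P.X (2 * n)}
    {Z : Scheme.{0}} {κ : Z ⟶ P.X.left} (hκ : IsClosedImmersion κ) (hint : AlgebraicGeometry.IsIntegral Z)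
    (hcoh : ∀ z ∈ Set.range κ.base, (n : ℕ∞) ≤ Order.coheight z)
    (hcohp : ∃ z : Z, Order.coheight (κ.base z) = (n : ℕ∞)) {q : ℚ}
    (hsupp : ((q : ℚ) : ℂ) • cupPowTwo h n + w ∈ classesSupportedOn P.X (Set.range κ.base) (2 * n))
    (hL : LiftsAlongWeilFamilies (2 * n) n d P Z κ) : WeilAnchorLocalClause n d P h w := by
  intro 𝒳 S f hf h𝒳qp hSqp hirr hsm hfib H W hH hW s₀ e' hH₀ hW₀
  haveI := hsm
  haveI := hκ
  haveI := hint
  -- the global class `B = q·Hⁿ + W`: fibre restrictions, Hodge type, value at the anchor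
  set B : complexBetti 𝒳 (2 * n) := ((q : ℚ) : ℂ) • cupPowTwo H n + W with hBdef
  have hres : ∀ s : ComplexPoints S, complexBetti.map (fiberι f s) (2 * n) B =
      ((q : ℚ) : ℂ) • cupPowTwo (complexBetti.map (fiberι f s) 2 H) n +
        complexBetti.map (fiberι f s) (2 * n) W := by
    intro s
    rw [hBdef, map_add, map_smul, complexBetti_map_cupPowTwo']
  have hBhodge : ∀ s : ComplexPoints S,
      IsOfHodgeType (2 * n) (fiberOver f s) (2 * n) n n (complexBetti.map (fiberι f s) (2 * n) B) := by
    intro s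
    rw [hres]
    exact ((isOfHodgeType_cupPowTwo (hf.isSmoothProjective s) (hH s).2 n).smul _).add
      (hf.isSmoothProjective s) (hW s).2
  have hx : complexBetti.map e'.hom (2 * n) (complexBetti.map (fiberι f s₀) (2 * n) B) =
      ((q : ℚ) : ℂ) • cupPowTwo h n + w := by
    rw [hres, map_add, map_smul, complexBetti_map_cupPowTwo', hH₀, hW₀]
  -- degenerate case `B|_{X₀} = 0`: the flat section vanishes near `s₀` and `0` is algebraic
  by_cases h0 : complexBetti.map (fiberι f s₀) (2 * n) B = 0
  · obtain ⟨U, hU, hs₀U, hrig⟩ := exists_isOpen_forall_map_fiberι_eq_zero f hf s₀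
    refine ⟨{t | t.pt ∈ U}, q, AlgPoints.isOpen_setOf_pt_mem (X := S) (L := ℂ) ⟨U, hU⟩, hs₀U,
      fun s hs => ?_⟩
    rw [← hres, hrig (2 * n) B h0 s hs]
    exact Submodule.zero_mem _
  -- transport along the chart `e' : P.X ≅ X₀`: `B|_{X₀} = (e'⁻¹)^*(q·hⁿ + w)` is supported on `e'(Z)`
  have hih : ∀ x, e'.inv.left.base (e'.hom.left.base x) = x := fun x => by
    rw [← Scheme.Hom.comp_apply, ← Over.comp_left, e'.hom_inv_id]; rfl
  have hhi : ∀ y, e'.hom.left.base (e'.inv.left.base y) = y := fun y => by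
    rw [← Scheme.Hom.comp_apply, ← Over.comp_left, e'.inv_hom_id]; rfl
  have hrange : Set.range (κ ≫ e'.hom.left).base = e'.inv.left.base ⁻¹' Set.range κ.base := by
    ext y
    constructor
    · rintro ⟨z, rfl⟩
      exact ⟨z, by rw [Scheme.Hom.comp_apply, hih]⟩
    · rintro ⟨z, hz⟩
      exact ⟨z, by rw [Scheme.Hom.comp_apply, hz, hhi]⟩
  have hB₀ : complexBetti.map (fiberι f s₀) (2 * n) B =
      complexBetti.map e'.inv (2 * n) (((q : ℚ) : ℂ) • cupPowTwo h n + w) := by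
    rw [← hx, e'.complexBetti_map_inv_map_hom]
  have hsuppB : complexBetti.map (fiberι f s₀) (2 * n) B ∈
      classesSupportedOn (fiberOver f s₀) (Set.range (κ ≫ e'.hom.left).base) (2 * n) := by
    rw [hB₀, hrange, mem_classesSupportedOn_iff]
    exact complexBetti.restrictCompl_map_eq_zero e'.inv (mem_classesSupportedOn_iff.1 hsupp)
  have hcoh' : ∀ z : Z, (n : ℕ∞) ≤ Order.coheight ((κ ≫ e'.hom.left).base z) := fun z => by
    rw [Scheme.Hom.comp_apply, coheight_left_base_eq_of_iso e']
    exact hcoh _ ⟨z, rfl⟩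
  have hcohp' : ∃ z : Z, Order.coheight ((κ ≫ e'.hom.left).base z) = (n : ℕ∞) := by
    obtain ⟨z, hz⟩ := hcohp
    exact ⟨z, by rw [Scheme.Hom.comp_apply, coheight_left_base_eq_of_iso e', hz]⟩
  -- the clause family IS a `√-d`-Weil family (projective in Hartshorne's sense over the quasi-projective base)
  have hWeil : IsWeilTypeFamily (2 * n) d f :=
    ⟨⟨hf, exists_isClosedImmersion_of_isSmoothProjectiveFamily hf h𝒳qp, hsm, hirr⟩, hSqp, hfib⟩
  -- Bloch's class hypothesis along `f` is WITNESSED by `B`; so `Z` lifts (hypothesis `hL`), and the ENGINE spreads `B`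
  have hlift : HasEtaleLocalFlatLift f s₀ Z (κ ≫ e'.hom.left) :=
    hL f s₀ e' hWeil
      (classStaysHodge_of_globalClass f (2 * n) n s₀ (κ ≫ e'.hom.left) hcoh' hcohp' B hBhodge hsuppB h0)
  obtain ⟨U, hUo, hs₀U, hU⟩ := spread_of_etaleLocalFlatLift_of_fulton hF f (2 * n) n hf hsm s₀ Z
    (κ ≫ e'.hom.left) inferInstance hint hcoh' hcohp' hlift B hsuppB
  refine ⟨U, q, hUo, hs₀U, fun s hs => ?_⟩
  rw [← hres]
  exact hU s hs

/-- **BLOCH ASYMMETRY, pointwise** (memo ROUND-3-RIGIDITY §3 E-b, typed): for an integral closed `Z ⊂ P` of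
codimension exactly `n` carrying `q·hⁿ + w`, EITHER `Z` is rigid-obstructed along some `√-d`-Weil family through `P`
along which its class stays Hodge (the shape of (R)), OR `(P, h, w)` satisfies Door A's local clause. No class-level
law separates the two cases (the class stays Hodge on the whole versal Weil family in both). -/
theorem weilRigidObstructed_or_localClause (hF : fulton1998_flatFamily_cycleClass_specialises)
    {n d : ℕ} {P : AbelianVariety ℂ} {h : complexBetti P.X 2} {w : complexBetti P.X (2 * n)}
    {Z : Scheme.{0}} {κ : Z ⟶ P.X.left} (hκ : IsClosedImmersion κ) (hint : AlgebraicGeometry.IsIntegral Z)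
    (hcoh : ∀ z ∈ Set.range κ.base, (n : ℕ∞) ≤ Order.coheight z)
    (hcohp : ∃ z : Z, Order.coheight (κ.base z) = (n : ℕ∞)) {q : ℚ}
    (hsupp : ((q : ℚ) : ℂ) • cupPowTwo h n + w ∈ classesSupportedOn P.X (Set.range κ.base) (2 * n)) :
    WeilRigidObstructed (2 * n) n d P Z κ ∨ WeilAnchorLocalClause n d P h w := by
  by_cases hR : WeilRigidObstructed (2 * n) n d P Z κ
  · exact Or.inl hR
  · exact Or.inr (weilAnchorLocalClause_of_liftsAlongWeilFamilies hF hκ hint hcoh hcohp hsupp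
      (liftsAlongWeilFamilies_iff_not_weilRigidObstructed.2 hR))

/-! ### The Schoen dichotomy -/

/-- **A LIFTABLE SCHOEN CYCLE IS A LOCALLY ALGEBRAIC ANCHOR at `(4, 3)`.** On a hyperbolically polarised frame, a
Schoen cycle `Z` (integral, codimension exactly `4`, class line through `q·h_K⁴ + w`, `w ≠ 0` a rational Weil class)
that is NOT rigid-obstructed delivers `HasLocallyAlgebraicWeilAnchor 4 3` — Door A's first conjunct for `ℚ(√-3)`,
with anchor `(B₁, ψ₀, e, a, w)` itself (`hasLocallyAlgebraicWeilAnchor_iff` + Door L). The curve-built clause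
`IsNormBuilt` and the CM data are NOT used. -/
theorem hasLocallyAlgebraicWeilAnchor_of_liftable_schoenCycle (hF : fulton1998_flatFamily_cycleClass_specialises)
    {C : SchemeOver ℂ} {𝒥 : Jacobian C} {σ : C ⟶ C} {f : 𝒥.J ⟶ 𝒥.J}
    {ψ₀ : AbelianVariety.image f ⟶ AbelianVariety.image f} {e : ProjectiveEmbedding (AbelianVariety.image f).X}
    {a : complexBetti (projectiveSpace e.n ℂ) 2} (hdim : (AbelianVariety.image f).dim = 2 * 4)
    (hψ : ψ₀ ≫ ψ₀ = -((3 : ℕ) • 𝟙 (AbelianVariety.image f))) (ha : IsRationalClass a) (ha0 : a ≠ 0)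
    (hhyp : IsHyperbolicWeilType (AbelianVariety.image f) ψ₀ 4 (hK ψ₀ e a))
    {Z : Scheme.{0}} {κ : Z ⟶ (AbelianVariety.image f).X.left} (hZ : SchoenCycleAt C 𝒥 σ f ψ₀ e a Z κ)
    (hL : LiftsAlongWeilFamilies (2 * 4) 4 3 (AbelianVariety.image f) Z κ) :
    HasLocallyAlgebraicWeilAnchor 4 3 := by
  obtain ⟨hκ, hint, hcoh, hcohp, -, q, w, hwW, hwrat, hw0, hsupp⟩ := hZ
  exact (hasLocallyAlgebraicWeilAnchor_iff 4 3).2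
    ⟨AbelianVariety.image f, ψ₀, e, a, w, hdim, hψ, ha, ha0, hhyp, hwW, hwrat, hw0,
      weilAnchorLocalClause_of_liftsAlongWeilFamilies hF hκ hint hcoh hcohp hsupp hL⟩

/-- **¬(Rʰ) ⟹ Door A's local input at `(4, 3)`**: a frame and a Schoen cycle violating (Rʰ) is a liftable Schoen
cycle on a hyperbolically polarised frame. -/
theorem hasLocallyAlgebraicWeilAnchor_of_not_schoenRigidityHyp
    (hF : fulton1998_flatFamily_cycleClass_specialises) (hR : ¬ SchoenRigidityHyp) :
    HasLocallyAlgebraicWeilAnchor 4 3 := by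
  unfold SchoenRigidityHyp at hR
  push Not at hR
  obtain ⟨C, 𝒥, σ, s, f, ψ₀, e, a, -, -, -, hdim, hψ, ha, ha0, hhyp, Z, κ, hZ, hnot⟩ := hR
  exact hasLocallyAlgebraicWeilAnchor_of_liftable_schoenCycle hF hdim hψ ha ha0 hhyp hZ
    (liftsAlongWeilFamilies_iff_not_weilRigidObstructed.2 hnot)

/-- **THE SCHOEN DICHOTOMY** (plan g6): granting Fulton's flat-family cycle class, EITHER the rigidity theorem (Rʰ)
holds — every Schoen cycle on every hyperbolically polarised CM-48 frame is rigid-obstructed along some `√-3`-Weil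
family: the bankable barrier «curve-built cycles are never seeds on cyclic Prym Weil families» — OR Door A's local
input `HasLocallyAlgebraicWeilAnchor 4 3` HOLDS, witnessed by Schoen's own `(B₁, F_c)`. Excluded middle on (Rʰ). -/
theorem schoen_dichotomy (hF : fulton1998_flatFamily_cycleClass_specialises) :
    SchoenRigidityHyp ∨ HasLocallyAlgebraicWeilAnchor 4 3 :=
  (Classical.em SchoenRigidityHyp).imp_right (hasLocallyAlgebraicWeilAnchor_of_not_schoenRigidityHyp hF)

/-- **… hence, if (Rʰ) FAILS, the Weil classes of EVERY `ℚ(√-3)`-Weil abelian SIXFOLD are algebraic** — through the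
tree's Door A[3] (`WeilTypeLadder.weilSixfolds_slice_of_reach_of_localAnchor_four`, fed by Deligne's reach
`weilFamilyReach_hyperbolic`). The kernel-checked COMPLEMENT of round 3's barrier: failure of (R) on a hyperbolic frame
is Door A's missing input, not a loss. Trust base: Fulton's fact + Deligne/van Geemen reach (both named, refereed).
[cite: Deligne1982HodgeCycles, proof of Thm. 4.8] [cite: vanGeemen1994HodgeAV, 5.2–5.11, 6.12]
[cite: Schoen1988HodgeWeil, Thm 3.3] -/
theorem weilSixfolds_three_of_not_schoenRigidityHyp (hF : fulton1998_flatFamily_cycleClass_specialises)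
    (hD : weilFamilyReach_hyperbolic) (hR : ¬ SchoenRigidityHyp) :
    ∀ (A : AbelianVariety ℂ) (φ : A ⟶ A), A.dim = 2 * 3 → IsSmoothProjective (2 * 3) A.X →
      φ ≫ φ = -((3 : ℕ) • 𝟙 A) →
      ∀ c : complexBetti A.X (2 * 3), IsRationalClass c → IsOfHodgeType (2 * 3) A.X (2 * 3) 3 3 c →
        c ∈ weilClassesOf A φ 3 3 → c ∈ algebraicClasses A.X 3 :=
  weilSixfolds_slice_of_reach_of_localAnchor_four 3 (by norm_num) hD
    (hasLocallyAlgebraicWeilAnchor_of_not_schoenRigidityHyp hF hR)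

end Summit.HodgeConjecture.HodgeConjecture.Theorems.BlochSeedDiscThree

end
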